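import Literature.IUT.LogVolume.DHProbabilisticSzpiroCorrected
import HarnessLib

/-!
# Dupuy–Hilado (arXiv:2004.13108v2) §8.6: the assembly of Explicit Szpiro — (8.10) PROVED from the typed
# inputs (8.9), (8.3), (8.4), (8.5), (8.7), (3.2); (8.1) with the exponent the chain supports

PROOF-ONLY sequel of `DHProbabilisticSzpiroCorrected` over the typed candidates of `DHExplicitSzpiro`
(T. Dupuy, A. Hilado, arXiv:2004.13108v2 [DupuyHilado2020], UNREFEREED; held render
`book:anonnd-2004-13108v2`, locators `p.N l.M`). The typed `ExplicitSzpiroClaim` (Thm 8.2.1 = Thm 1.0.5,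
§8.6 "as printed") is `hypotheses → Ineq810 ∧ ExplicitSzpiroIneq`, where every analytic / arithmetic input
is one of its hypotheses: (8.9) `Ineq89` (the ONLY entrance of [IUTchIII] Cor. 3.12 and Claim 5.0.1),
(8.3) `ArchBound83`, (8.4) `LargePlacesBound84`, (8.5) `Lemma841`, (8.7) `SmallPlacesBound87`, (3.2)
`PilotDegreeFormula`, and the constants step `ConstantsBound` (p.35 l.60–73, Dusart). What is PROVED here:

* **(8.10)** p.35 l.55–59 from those hypotheses, for every datum (`ineq810_of_inputs`): the §8.6
  bookkeeping p.35 l.1–59 (split `Σ_p = Σ_{p≤B} + Σ_{p>B}`, divide by `l+5`, the coefficient identity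
  `explicitCoeff_eq`, and the weakenings `(l+3)/(l+5) ≤ 1`, `1/2 ≤ 1`, `1/4 ≤ 1` the print makes silently)
  — this DISCHARGES the first conjunct of `ExplicitSzpiroClaim` as printed.
* **(8.1) with the exponent the chain yields** (`explicitSzpiro_of_ineq810`, `explicitSzpiroClaim_corrected`):
  multiplying (8.10) by `24 + ε_l` and exponentiating gives
  `|Δ^min_{E/F}| ≤ exp((24+ε_l)·(A₀d₀²l⁴ + B₀d₀)) · (|Cond(E/F)|·|Disc(F/ℚ)|)^{24+ε_l}`.
  AS PRINTED, (8.1) = (1.7) (p.31 l.7–8, p.4 l.8–12; typed `ExplicitSzpiroIneq`) reads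
  `e^{A₀d₀²l⁴+B₀d₀}` — WITHOUT the factor `24 + ε_l` (`≥ 24`) in the exponential that "rewriting (8.10)
  multiplicatively" (p.35 l.73–74) produces; `A₀ = d₁²(1 + 1.3/ln d₁) = 84372107405`, `B₀ = d₁·ln π = 316495`
  (p.35 l.60–73) carry no such factor. Recorded as a kernel fact about what the printed derivation supports
  — nothing is claimed about the truth of the printed (1.7) itself, which stays a typed candidate.
* `conductorNorm_ringOfIntegers_pos`: `N(𝔣(E/F)) > 0` (the conductor ideal is a `finprod` of prime powers;
  same argument as the tree's `conductorNorm_pos_holds` over `ℤ`).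

HONEST FRAMING: elementary real algebra downstream of typed hypotheses; nothing here asserts, uses or bears
on the disputed [IUTchIII] Cor. 3.12 [claim: Mochizuki2012, status: disputed] or Claim 5.0.1 beyond their
appearance inside the hypothesis `Ineq89` [claim: DupuyHilado2020, status: under-review], never asserted.
Typed ≠ proved ≠ endorsed; no side is taken on any author; no abc claim.
-/

noncomputable section

namespace Literature.IUT.LogVolume

open NumberField IsDedekindDomain Finset

namespace ExplicitSzpiro

variable {F₀ : Type*} [Field F₀] [NumberField F₀] (X : PilotData F₀) (R : SectionRamification F₀)

/-- `N(𝔣(E/F)) = #(𝓞_F/𝔣) > 0`: the conductor ideal `∏ᶠ_v 𝔭_v^{f_v}` of `𝓞_F` is a `finprod` of non-zero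
prime powers (or its junk value `1`), hence non-zero, so its absolute norm is positive (the argument of
the tree's `WeierstrassCurve.conductorNorm_pos_holds` over `ℤ`, verbatim over `𝓞_F`).
[cite: SilvermanAEC2009, C.16] -/
theorem conductorNorm_ringOfIntegers_pos {F : Type*} [Field F] [NumberField F] (E : WeierstrassCurve F) :
    0 < E.conductorNorm (𝓞 F) := by
  unfold WeierstrassCurve.conductorNorm WeierstrassCurve.conductor
  rw [Nat.pos_iff_ne_zero, Ne, Ideal.absNorm_eq_zero_iff]
  refine finprod_induction (fun I : Ideal (𝓞 F) ↦ I ≠ ⊥) ?_ ?_ ?_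
  · exact (Ideal.one_eq_top (R := 𝓞 F)) ▸ top_ne_bot
  · intro I J hI hJ
    exact mul_ne_zero hI hJ
  · intro v
    exact pow_ne_zero _ v.ne_bot

/-- `ε_l = 96(l+3)/(l²+l−12) > 0` for `l ≥ 4`. [cite: DupuyHilado2020, Thm 1.0.5 p.4 l.12] -/
theorem epsExplicit_pos (l : ℕ) (hl : 4 ≤ l) : 0 < epsExplicit l := by
  have hl' : (4 : ℝ) ≤ l := by exact_mod_cast hl
  unfold epsExplicit
  exact div_pos (by positivity) (by nlinarith)

/-- **(8.10) PROVED from the typed inputs of §8.6** (p.35 l.1–59): for every pilot datum `X`, section datum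
`R`, prime set `T`, log-shell data `lnμI`, `g∞`, number field `K` (standing for the `l`-division field,
through `|Disc(K/ℚ)|`) and curve `E/F`, the hypotheses (8.9), (8.3), (8.4), (8.5), (8.7), (3.2) of
`ExplicitSzpiroClaim` imply `Ineq810 E l B_{l,d₀}`:
`(1/(24+ε_l))·ln|Δ^min_{E/F}| ≤ [ln(B)π(B) + ln(π)]·[F:ℚ] + ln|Disc(F/ℚ)| + ln|Cond(E/F)|`.
[cite: DupuyHilado2020, §8.6 (8.10) p.35 l.1–59] -/
theorem ineq810_of_inputs (T : Finset ℕ)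
    (lnμI : (p : ℕ) → (j : ℕ) → (Fin (j + 1) → placesOver F₀ p) → ℝ) (gArch : ℕ → ℝ)
    {F : Type*} [Field F] [NumberField F] (K : Type*) [Field K] [NumberField K] (E : WeierstrassCurve F)
    (h89 : Ineq89 X R T lnμI gArch) (h83 : ArchBound83 X gArch)
    (h84 : LargePlacesBound84 X R T lnμI (Bld0 X.l (Module.finrank ℚ F₀)) (NumberField.discr K).natAbs)
    (h841 : Lemma841 K E (Bld0 X.l (Module.finrank ℚ F₀)))
    (h87 : SmallPlacesBound87 X R T lnμI (Bld0 X.l (Module.finrank ℚ F₀)))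
    (h32 : PilotDegreeFormula X E) :
    Ineq810 E X.l (Bld0 X.l (Module.finrank ℚ F₀)) := by
  classical
  set B : ℕ := Bld0 X.l (Module.finrank ℚ F₀) with hB
  have hl2 := X.two_le_lstar
  have hL : (2 : ℝ) ≤ X.lstar := by exact_mod_cast hl2
  have h4 : 4 ≤ X.l := by have := X.five_le_l; omega
  have hdF : (0 : ℝ) < Module.finrank ℚ F := by exact_mod_cast Module.finrank_pos
  -- the nonnegative quantities the print drops or weakens silently
  have hP1 : 0 ≤ Real.log (B : ℝ) * (Nat.primeCounting B : ℝ) :=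
    mul_nonneg (Real.log_natCast_nonneg B) (Nat.cast_nonneg _)
  have hLπ : 0 ≤ Real.log Real.pi := Real.log_nonneg (by linarith [Real.pi_gt_three])
  have hDisc : 0 ≤ Real.log |(NumberField.discr F : ℝ)| := by
    apply Real.log_nonneg
    have h1 : (1 : ℤ) ≤ |NumberField.discr F| := Int.one_le_abs (NumberField.discr_ne_zero F)
    have h2 : ((1 : ℤ) : ℝ) ≤ ((|NumberField.discr F| : ℤ) : ℝ) := by exact_mod_cast h1
    simpa [Int.cast_abs] using h2
  have hCond : 0 ≤ Real.log (E.conductorNorm (𝓞 F) : ℝ) := Real.log_natCast_nonneg _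
  -- split the sum over `T` at `B` (p.35 l.16–28)
  have hsplit : ∑ p ∈ T, E2prime X R lnμI p =
      (∑ p ∈ T.filter (fun p => p ≤ B), E2prime X R lnμI p) +
        ∑ p ∈ T.filter (fun p => B < p), E2prime X R lnμI p := by
    rw [← Finset.sum_filter_add_sum_filter_not T (fun p => p ≤ B)]
    congr 2
    exact Finset.filter_congr fun p _ => not_le
  -- assemble the printed right-hand side (p.35 l.29–39)
  have key : ((((X.lstar : ℝ) + 1) * (2 * X.lstar + 1) / 6) - 1) *
      ((1 / (2 * (X.l : ℝ))) * (Real.log (E.minimalDiscriminantNorm (𝓞 F)) / Module.finrank ℚ F)) ≤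
      ((2 * (X.lstar : ℝ) + 1) + 3) * Real.log B * Nat.primeCounting B
        + (((2 * (X.lstar : ℝ) + 1) + 5) / 4) *
            (2 * ((Real.log |(NumberField.discr F : ℝ)| + Real.log (E.conductorNorm (𝓞 F))) /
              Module.finrank ℚ F))
        + (((2 * (X.lstar : ℝ) + 1) + 5) / 4) * Real.log Real.pi := by
    have hlhs : LgpDivisor.ndegLgp X.thetaPilot - FinDivisor.ndeg F₀ X.qPilot =
        ((((X.lstar : ℝ) + 1) * (2 * X.lstar + 1) / 6) - 1) *
          ((1 / (2 * (X.l : ℝ))) * (Real.log (E.minimalDiscriminantNorm (𝓞 F)) / Module.finrank ℚ F)) := by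
      unfold PilotDegreeFormula at h32
      rw [ndegLgp_thetaPilot, h32]
      ring
    unfold Ineq89 at h89
    unfold ArchBound83 at h83
    unfold LargePlacesBound84 at h84
    unfold Lemma841 at h841
    unfold SmallPlacesBound87 at h87
    rw [hlhs, hsplit] at h89
    have h84' := h84.trans (mul_le_mul_of_nonneg_left h841 (by positivity))
    linarith
  -- divide by `l + 5` and compare coefficients (p.35 l.40–59)
  unfold Ineq810
  have hcoef : 1 / (24 + epsExplicit X.l) =
      ((((X.lstar : ℝ) + 1) * (2 * X.lstar + 1) / 6) - 1) * (1 / (2 * (X.l : ℝ))) * (1 / ((X.l : ℝ) + 5)) := by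
    rw [← explicitCoeff_eq X.l h4, X.l_cast]
    ring
  rw [hcoef]
  rw [X.l_cast] at key ⊢
  set Q : ℝ := Real.log (E.minimalDiscriminantNorm (𝓞 F)) with hQ
  set dF : ℝ := (Module.finrank ℚ F : ℝ) with hdF'
  set S : ℝ := Real.log |(NumberField.discr F : ℝ)| + Real.log (E.conductorNorm (𝓞 F)) with hS
  set P1 : ℝ := Real.log (B : ℝ) * (Nat.primeCounting B : ℝ) with hP1'
  have hS0 : 0 ≤ S := add_nonneg hDisc hCond
  have hl5 : (0 : ℝ) < (2 * (X.lstar : ℝ) + 1) + 5 := by positivity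
  have step1 : ((((X.lstar : ℝ) + 1) * (2 * X.lstar + 1) / 6) - 1) * (1 / (2 * (2 * (X.lstar : ℝ) + 1))) *
        (1 / ((2 * (X.lstar : ℝ) + 1) + 5)) * Q =
      (((((X.lstar : ℝ) + 1) * (2 * X.lstar + 1) / 6) - 1) * ((1 / (2 * (2 * (X.lstar : ℝ) + 1))) * (Q / dF)))
        * (dF / ((2 * (X.lstar : ℝ) + 1) + 5)) := by
    field_simp
  have step2 : (((((X.lstar : ℝ) + 1) * (2 * X.lstar + 1) / 6) - 1) * ((1 / (2 * (2 * (X.lstar : ℝ) + 1))) * (Q / dF)))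
        * (dF / ((2 * (X.lstar : ℝ) + 1) + 5)) ≤
      (((2 * (X.lstar : ℝ) + 1) + 3) * P1
        + (((2 * (X.lstar : ℝ) + 1) + 5) / 4) * (2 * (S / dF))
        + (((2 * (X.lstar : ℝ) + 1) + 5) / 4) * Real.log Real.pi) * (dF / ((2 * (X.lstar : ℝ) + 1) + 5)) := by
    refine mul_le_mul_of_nonneg_right ?_ (by positivity)
    have : ((2 * (X.lstar : ℝ) + 1) + 3) * Real.log ↑B * ↑(Nat.primeCounting B) =
        ((2 * (X.lstar : ℝ) + 1) + 3) * P1 := by rw [hP1']; ring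
    linarith [key, this]
  have step3 : (((2 * (X.lstar : ℝ) + 1) + 3) * P1
        + (((2 * (X.lstar : ℝ) + 1) + 5) / 4) * (2 * (S / dF))
        + (((2 * (X.lstar : ℝ) + 1) + 5) / 4) * Real.log Real.pi) * (dF / ((2 * (X.lstar : ℝ) + 1) + 5)) =
      (((2 * (X.lstar : ℝ) + 1) + 3) / ((2 * (X.lstar : ℝ) + 1) + 5)) * (P1 * dF) + S / 2
        + (Real.log Real.pi * dF) / 4 := by
    field_simp
    ring
  have step4 : (((2 * (X.lstar : ℝ) + 1) + 3) / ((2 * (X.lstar : ℝ) + 1) + 5)) * (P1 * dF) ≤ P1 * dF := by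
    refine mul_le_of_le_one_left (mul_nonneg hP1 hdF.le) ?_
    rw [div_le_one hl5]
    linarith
  have hπdF : 0 ≤ Real.log Real.pi * dF := mul_nonneg hLπ hdF.le
  calc ((((X.lstar : ℝ) + 1) * (2 * X.lstar + 1) / 6) - 1) * (1 / (2 * (2 * (X.lstar : ℝ) + 1))) *
          (1 / ((2 * (X.lstar : ℝ) + 1) + 5)) * Q
      = (((((X.lstar : ℝ) + 1) * (2 * X.lstar + 1) / 6) - 1) * ((1 / (2 * (2 * (X.lstar : ℝ) + 1))) * (Q / dF)))
          * (dF / ((2 * (X.lstar : ℝ) + 1) + 5)) := step1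
    _ ≤ (((2 * (X.lstar : ℝ) + 1) + 3) / ((2 * (X.lstar : ℝ) + 1) + 5)) * (P1 * dF) + S / 2
          + (Real.log Real.pi * dF) / 4 := step2.trans_eq step3
    _ ≤ (P1 + Real.log Real.pi) * dF + S := by nlinarith [step4, hS0, hπdF, mul_nonneg hP1 hdF.le]
    _ = (P1 + Real.log Real.pi) * dF + Real.log |(NumberField.discr F : ℝ)| +
          Real.log (E.conductorNorm (𝓞 F) : ℝ) := by rw [hS]; ring

/-- **(8.1) with the exponent the chain supports**, from (8.10) and the constants step (p.35 l.60–74):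
`Ineq810 E l B_{l,d₀}`, `ConstantsBound l d₀` and `[F:ℚ] ≤ d₁·d₀` give
`|Δ^min_{E/F}| ≤ exp((24+ε_l)·(A₀d₀²l⁴ + B₀d₀))·(|Cond(E/F)|·|Disc(F/ℚ)|)^{24+ε_l}` (`l ≥ 4`). The printed
(8.1)/(1.7) (`ExplicitSzpiroIneq`) has `exp(A₀d₀²l⁴ + B₀d₀)` instead: multiplying (8.10) through by
`24 + ε_l` puts that factor on BOTH summands, and `A₀, B₀` (p.35 l.60–73) do not absorb it.
[cite: DupuyHilado2020, Thm 8.2.1 (8.1) p.31 l.3–8; §8.6 p.35 l.55–74] -/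
theorem explicitSzpiro_of_ineq810 {F : Type*} [Field F] [NumberField F] (E : WeierstrassCurve F)
    (l d0 : ℕ) (hl : 4 ≤ l) (h810 : Ineq810 E l (Bld0 l d0)) (hC : ConstantsBound l d0)
    (hdeg : Module.finrank ℚ F ≤ d1 * d0) :
    (E.minimalDiscriminantNorm (𝓞 F) : ℝ) ≤
      Real.exp ((24 + epsExplicit l) * ((A0 : ℝ) * (d0 : ℝ) ^ 2 * (l : ℝ) ^ 4 + B0 * d0)) *
        ((E.conductorNorm (𝓞 F) : ℝ) * |(NumberField.discr F : ℝ)|) ^ (24 + epsExplicit l) := by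
  have hε : 0 < 24 + epsExplicit l := by linarith [epsExplicit_pos l hl]
  have hCond : (0 : ℝ) < E.conductorNorm (𝓞 F) := by exact_mod_cast conductorNorm_ringOfIntegers_pos E
  have hDisc : (0 : ℝ) < |(NumberField.discr F : ℝ)| :=
    abs_pos.mpr (by exact_mod_cast NumberField.discr_ne_zero F)
  have hN : (0 : ℝ) < (E.conductorNorm (𝓞 F) : ℝ) * |(NumberField.discr F : ℝ)| := mul_pos hCond hDisc
  rcases Nat.eq_zero_or_pos (E.minimalDiscriminantNorm (𝓞 F)) with h0 | hpos
  · rw [h0]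
    push_cast
    positivity
  have hΔ : (0 : ℝ) < E.minimalDiscriminantNorm (𝓞 F) := by exact_mod_cast hpos
  unfold Ineq810 at h810
  have hC' := hC (Module.finrank ℚ F) hdeg
  -- `ln|Δ| ≤ (24+ε)(A₀d₀²l⁴ + B₀d₀) + (24+ε)(ln Cond + ln|Disc|)`
  have hlog : Real.log (E.minimalDiscriminantNorm (𝓞 F)) ≤
      (24 + epsExplicit l) * ((A0 : ℝ) * (d0 : ℝ) ^ 2 * (l : ℝ) ^ 4 + B0 * d0) +
        (24 + epsExplicit l) * (Real.log (E.conductorNorm (𝓞 F) : ℝ) + Real.log |(NumberField.discr F : ℝ)|) := by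
    have h1 : Real.log (E.minimalDiscriminantNorm (𝓞 F)) ≤
        (24 + epsExplicit l) * ((Real.log (Bld0 l d0 : ℕ) * Nat.primeCounting (Bld0 l d0) + Real.log Real.pi) *
          Module.finrank ℚ F + Real.log |(NumberField.discr F : ℝ)| + Real.log (E.conductorNorm (𝓞 F))) := by
      have := mul_le_mul_of_nonneg_left h810 hε.le
      rwa [← mul_assoc, mul_one_div_cancel hε.ne', one_mul] at this
    have h2 := mul_le_mul_of_nonneg_left hC' hε.le
    nlinarith [h1, h2]
  calc (E.minimalDiscriminantNorm (𝓞 F) : ℝ)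
      = Real.exp (Real.log (E.minimalDiscriminantNorm (𝓞 F))) := (Real.exp_log hΔ).symm
    _ ≤ Real.exp ((24 + epsExplicit l) * ((A0 : ℝ) * (d0 : ℝ) ^ 2 * (l : ℝ) ^ 4 + B0 * d0) +
          (24 + epsExplicit l) *
            (Real.log (E.conductorNorm (𝓞 F) : ℝ) + Real.log |(NumberField.discr F : ℝ)|)) :=
        Real.exp_le_exp.mpr hlog
    _ = Real.exp ((24 + epsExplicit l) * ((A0 : ℝ) * (d0 : ℝ) ^ 2 * (l : ℝ) ^ 4 + B0 * d0)) *
          ((E.conductorNorm (𝓞 F) : ℝ) * |(NumberField.discr F : ℝ)|) ^ (24 + epsExplicit l) := by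
        rw [Real.exp_add, Real.rpow_def_of_pos hN, Real.log_mul hCond.ne' hDisc.ne', mul_comm (Real.log _ + _)]

/-- **Theorem 8.2.1 = 1.0.5, the §8.6 assembly with the exponent the chain supports** (PROVED): under exactly
the hypotheses of the typed `ExplicitSzpiroClaim` — primes `T` ⊇ residue characteristics of `S`,
`[F:ℚ] ≤ d₁·[F₀:ℚ]`, (8.9), (8.3), (8.4) with `B = B_{l,d₀}`, (8.5), (8.7), (3.2), the constants bound —
one gets (8.10) AND `|Δ^min_{E/F}| ≤ exp((24+ε_l)(A₀d₀²l⁴ + B₀d₀))·(|Cond(E/F)|·|Disc(F/ℚ)|)^{24+ε_l}`.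
The first conjunct is the printed one; the second differs from the printed (8.1) (`ExplicitSzpiroIneq`) by
the factor `24 + ε_l` inside the exponential. Candidate inputs stay hypotheses; nothing is asserted.
[claim: DupuyHilado2020, status: under-review] [cite: DupuyHilado2020, Thm 8.2.1 p.31 l.3–10; §8.6 p.35 l.1–74] -/
theorem explicitSzpiroClaim_corrected (T : Finset ℕ)
    (lnμI : (p : ℕ) → (j : ℕ) → (Fin (j + 1) → placesOver F₀ p) → ℝ) (gArch : ℕ → ℝ)
    {F : Type*} [Field F] [NumberField F] (K : Type*) [Field K] [NumberField K] (E : WeierstrassCurve F)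
    (hdeg : Module.finrank ℚ F ≤ d1 * Module.finrank ℚ F₀)
    (h89 : Ineq89 X R T lnμI gArch) (h83 : ArchBound83 X gArch)
    (h84 : LargePlacesBound84 X R T lnμI (Bld0 X.l (Module.finrank ℚ F₀)) (NumberField.discr K).natAbs)
    (h841 : Lemma841 K E (Bld0 X.l (Module.finrank ℚ F₀)))
    (h87 : SmallPlacesBound87 X R T lnμI (Bld0 X.l (Module.finrank ℚ F₀)))
    (h32 : PilotDegreeFormula X E) (hC : ConstantsBound X.l (Module.finrank ℚ F₀)) :
    Ineq810 E X.l (Bld0 X.l (Module.finrank ℚ F₀)) ∧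
      (E.minimalDiscriminantNorm (𝓞 F) : ℝ) ≤
        Real.exp ((24 + epsExplicit X.l) *
            ((A0 : ℝ) * (Module.finrank ℚ F₀ : ℝ) ^ 2 * (X.l : ℝ) ^ 4 + B0 * Module.finrank ℚ F₀)) *
          ((E.conductorNorm (𝓞 F) : ℝ) * |(NumberField.discr F : ℝ)|) ^ (24 + epsExplicit X.l) := by
  have h4 : 4 ≤ X.l := by have := X.five_le_l; omega
  have h810 := ineq810_of_inputs X R T lnμI gArch K E h89 h83 h84 h841 h87 h32
  exact ⟨h810, explicitSzpiro_of_ineq810 E X.l (Module.finrank ℚ F₀) h4 h810 hC hdeg⟩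

end ExplicitSzpiro

end Literature.IUT.LogVolume

end
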